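import Mathlib
import HarnessLib
import Literature.Probability.MarkovChains.TotalVariation
import Literature.Probability.MarkovChains.DistinguishingStatistic

/-!
# Total variation as a dual norm: `TV(P,Q) = ½ sup_{‖f‖_∞ ≤ 1} (E_P f − E_Q f)` (finite laws)

[cite: PolyanskiyWu2024, Thm 7.7(a) eq. (7.18)]

"sup-representation of TV: `TV(P,Q) = sup_E P(E) − Q(E) = ½ sup_{f ∈ 𝓕} E_P[f(X)] − E_Q[f(X)]`
… the second [supremum] is over `𝓕 = {f : 𝒳 → ℝ, ‖f‖_∞ ≤ 1}`" [cite: PolyanskiyWu2024, Thm 7.7(a)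
eq. (7.18)].  The event form is the tree's `tvDist_eq_sum_filter` / `sub_sum_le_tvDist`
(`MarkovChains/TotalVariation.lean`, [cite: LevinPeres2017, Prop. 4.2]); this file PROVES the
TEST-FUNCTION form for laws on a finite set written as functions (`tvDist`, and `lawMean μ f = Σ_x μ(x)f(x)`
of `DistinguishingStatistic.lean`; 0 named facts, no new definition):

* `abs_lawMean_sub_lawMean_le` — `|E_μ f − E_ν f| ≤ 2c · TV(μ,ν)` whenever `|f| ≤ c` (any two vectors;
  "choosing a particular `f` in (7.18) yields a lower bound" on `TV` [cite: PolyanskiyWu2024, §7.3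
  Remark 7.6]);
* `abs_lawMean_sub_lawMean_le_osc` — the sharper form for laws of equal mass: `m ≤ f ≤ M` gives
  `|E_μ f − E_ν f| ≤ (M − m) · TV(μ,ν)` ((7.18) applied to `g = (2f − M − m)/(M − m) ∈ 𝓕`; with
  `f = 1_A` this is the event bound `|μ(A) − ν(A)| ≤ TV`);
* `lawMean_sub_lawMean_sign` — the maximiser `f⋆ = sign(μ − ν)` (`+1` on `{ν ≤ μ}`, `−1` elsewhere)
  attains `E_μ f⋆ − E_ν f⋆ = 2·TV(μ,ν)`; hence `PolyanskiyWu2024_eq_7_18`: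
  `2·TV(μ,ν)` IS THE GREATEST value of `E_μ f − E_ν f` over `‖f‖_∞ ≤ 1` (`IsGreatest`, the finite `sup`).

Context (cell pub-lqcd, venture LatticeQCDFlow): the BIAS of any bounded observable measured on a
sampler whose law is `μ` instead of the target `π` is at most `osc(f) · TV(μ, π)` — the quantitative
meaning of a total-variation certificate for reported expectation values.
-/

namespace Literature.Probability.MarkovChains

open Finset

variable {X : Type*} [Fintype X]

/-- `E_μ f − E_ν f = Σ_x (μ(x) − ν(x)) f(x)`. [cite: PolyanskiyWu2024, Thm 7.7(a) (proof of (7.18))] -/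
theorem lawMean_sub_lawMean (μ ν : X → ℝ) (f : X → ℝ) :
    lawMean μ f - lawMean ν f = ∑ x, (μ x - ν x) * f x := by
  unfold lawMean
  rw [← sum_sub_distrib]
  exact sum_congr rfl fun x _ => by ring

/-- **Test functions bound TV from below** [cite: PolyanskiyWu2024, Thm 7.7(a) eq. (7.18)] (the `≤`
half, for any two vectors): if `|f| ≤ c` pointwise then `|E_μ f − E_ν f| ≤ 2c · TV(μ, ν)`. -/
theorem abs_lawMean_sub_lawMean_le (μ ν : X → ℝ) {f : X → ℝ} {c : ℝ} (hf : ∀ x, |f x| ≤ c) :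
    |lawMean μ f - lawMean ν f| ≤ 2 * c * tvDist μ ν := by
  rw [lawMean_sub_lawMean]
  unfold tvDist
  calc |∑ x, (μ x - ν x) * f x| ≤ ∑ x, |(μ x - ν x) * f x| := abs_sum_le_sum_abs _ _
    _ ≤ ∑ x, |μ x - ν x| * c := sum_le_sum fun x _ => by
        rw [abs_mul]
        exact mul_le_mul_of_nonneg_left (hf x) (abs_nonneg _)
    _ = 2 * c * ((1 / 2) * ∑ x, |μ x - ν x|) := by rw [← sum_mul]; ring

/-- **The oscillation form** for two laws of equal mass: if `m ≤ f ≤ M` then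
`|E_μ f − E_ν f| ≤ (M − m) · TV(μ, ν)` — (7.18) applied to `g = (2f − M − m)/(M − m)`, `‖g‖_∞ ≤ 1`
(equivalently: subtract the constant `(M + m)/2` first). [cite: PolyanskiyWu2024, Thm 7.7(a)
eq. (7.18)] -/
theorem abs_lawMean_sub_lawMean_le_osc {μ ν : X → ℝ} (hmass : ∑ x, μ x = ∑ x, ν x) {f : X → ℝ}
    {m M : ℝ} (hm : ∀ x, m ≤ f x) (hM : ∀ x, f x ≤ M) :
    |lawMean μ f - lawMean ν f| ≤ (M - m) * tvDist μ ν := by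
  -- recentre: `Σ (μ − ν) f = Σ (μ − ν)(f − (M+m)/2)` because the masses agree
  have hre : lawMean μ f - lawMean ν f
      = lawMean μ (fun x => f x - (M + m) / 2) - lawMean ν (fun x => f x - (M + m) / 2) := by
    rw [lawMean_sub_lawMean, lawMean_sub_lawMean]
    have : ∑ x, (μ x - ν x) * ((M + m) / 2) = 0 := by
      rw [← sum_mul, sum_sub_distrib, hmass, sub_self, zero_mul]
    simp_rw [mul_sub, sum_sub_distrib, this, sub_zero]
  rw [hre]
  have h := abs_lawMean_sub_lawMean_le μ ν (f := fun x => f x - (M + m) / 2) (c := (M - m) / 2)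
    fun x => abs_le.2 ⟨by linarith [hm x], by linarith [hM x]⟩
  calc _ ≤ 2 * ((M - m) / 2) * tvDist μ ν := h
    _ = (M - m) * tvDist μ ν := by ring

/-- The bias form for events: `|μ(A) − ν(A)| ≤ TV(μ, ν)` for laws of equal mass (`f = 1_A`,
oscillation `1`). [cite: PolyanskiyWu2024, Thm 7.7(a) eq. (7.18) (first `sup`)] -/
theorem abs_sum_sub_sum_le_tvDist [DecidableEq X] {μ ν : X → ℝ} (hmass : ∑ x, μ x = ∑ x, ν x)
    (A : Finset X) : |∑ x ∈ A, μ x - ∑ x ∈ A, ν x| ≤ tvDist μ ν := by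
  have h := abs_lawMean_sub_lawMean_le_osc hmass (f := fun x => if x ∈ A then (1 : ℝ) else 0)
    (m := 0) (M := 1) (fun x => by split_ifs <;> norm_num) fun x => by split_ifs <;> norm_num
  unfold lawMean at h
  simp only [mul_ite, mul_one, mul_zero, ← sum_filter, filter_mem_eq_inter, univ_inter,
    sub_zero, one_mul] at h
  exact h

/-- **The maximiser**: with `f⋆ = sign(μ − ν)` (`+1` where `ν ≤ μ`, `−1` elsewhere), `‖f⋆‖_∞ ≤ 1` and
`E_μ f⋆ − E_ν f⋆ = Σ_x |μ(x) − ν(x)| = 2·TV(μ, ν)`. [cite: PolyanskiyWu2024, Thm 7.7(a) (proof of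
(7.18): "taking `f(x) = 2·1_E(x) − 1`" with `E = {p > q}`)] -/
theorem lawMean_sub_lawMean_sign (μ ν : X → ℝ) :
    lawMean μ (fun x => if ν x ≤ μ x then (1 : ℝ) else -1)
      - lawMean ν (fun x => if ν x ≤ μ x then (1 : ℝ) else -1) = 2 * tvDist μ ν := by
  rw [lawMean_sub_lawMean]
  unfold tvDist
  have e : ∀ x, (μ x - ν x) * (if ν x ≤ μ x then (1 : ℝ) else -1) = |μ x - ν x| := fun x => by
    split_ifs with h
    · rw [mul_one, abs_of_nonneg (by linarith)]
    · rw [mul_neg_one, abs_of_neg (by linarith [not_le.1 h])]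
  simp_rw [e]
  ring

/-- **Sup-representation of total variation** [cite: PolyanskiyWu2024, Thm 7.7(a) eq. (7.18)]:
`TV(P,Q) = ½ sup_{‖f‖_∞ ≤ 1} (E_P f − E_Q f)` — on a finite set the supremum is attained, and
`2·TV(μ, ν)` is the greatest element of `{E_μ f − E_ν f : |f| ≤ 1}`. -/
theorem PolyanskiyWu2024_eq_7_18 (μ ν : X → ℝ) :
    IsGreatest {d : ℝ | ∃ f : X → ℝ, (∀ x, |f x| ≤ 1) ∧ d = lawMean μ f - lawMean ν f}
      (2 * tvDist μ ν) := by
  constructor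
  · refine ⟨fun x => if ν x ≤ μ x then (1 : ℝ) else -1, fun x => ?_, (lawMean_sub_lawMean_sign μ ν).symm⟩
    show |(if ν x ≤ μ x then (1 : ℝ) else -1)| ≤ 1
    split_ifs <;> norm_num
  · rintro d ⟨f, hf, rfl⟩
    have h := abs_lawMean_sub_lawMean_le μ ν hf
    rw [mul_one] at h
    exact (le_abs_self _).trans h

end Literature.Probability.MarkovChains
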